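import Mathlib
import HarnessLib

/-!
# T72a — mean values of exponential sums over an interval (crude Hilbert inequality)

First file of the local pair-correlation rigidity line (sharpest statement §2k (xi), kernel plan
T72): the elementary mean-value inequality for a finite exponential sum
`D(t) = ∑_{i ∈ S} c_i e^{-i ν_i t}` over an interval,

  `∫_{T₁}^{T₂} |D(t)|² dt ≤ (T₂ - T₁) ∑_i |c_i|² + ∑_i |c_i|² ∑_{j ≠ i} 2/|ν_i - ν_j|`

(`norm_sq_expSum_intervalIntegral_le`): expand `|D|² = ∑_{i,j} c_i c̄_j e^{i(ν_j-ν_i)t}`, integrate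
termwise, bound each off-diagonal oscillatory integral by `2/|ν_i - ν_j|`
(`norm_intervalIntegral_cexp_mul_I_le`) and use `2|c_i||c_j| ≤ |c_i|² + |c_j|²`. This is the
crude form of the Montgomery–Vaughan mean value theorem (whose sharp constant replaces the double
sum by `3π δ⁻¹`, `δ` the minimal frequency gap); the crude form suffices for windows longer than
the square of the length of the sum. Specialised to Dirichlet polynomials (`ν_n = log n`,
`1 ≤ n ≤ N`, `|log n - log m| ≥ 1/N` for `n ≠ m`):

  `∫_{T₁}^{T₂} |∑_{n=1}^{N} c_n n^{-it}|² dt ≤ (T₂ - T₁ + 2N²) ∑_{n=1}^{N} |c_n|²`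

(`norm_sq_dirichletSum_intervalIntegral_le`). In the statements the `j = i` term of
`∑_j 2/|ν_i - ν_j|` is Lean's `2/0 = 0`, so no diagonal needs to be excluded.

References: H. L. Montgomery, R. C. Vaughan, *Hilbert's inequality*, J. London Math. Soc. (2) 8
(1974) 73–82 (sharp form); H. L. Montgomery, *The pair correlation of zeros of the zeta function*,
Proc. Sympos. Pure Math. 24 (1973) 181–193 (the use made of it in T72).
-/

open Complex Set MeasureTheory Finset
open scoped Real ComplexConjugate

namespace Summit.RiemannHypothesis.RiemannHypothesis.Theorems

/-- The oscillatory integral `∫_{T₁}^{T₂} e^{iθt} dt` has norm at most `2/|θ|` for `θ ≠ 0`. -/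
theorem norm_intervalIntegral_cexp_mul_I_le {θ : ℝ} (hθ : θ ≠ 0) (T₁ T₂ : ℝ) :
    ‖∫ t in T₁..T₂, cexp (((θ * t : ℝ) : ℂ) * I)‖ ≤ 2 / |θ| := by
  have hc : (θ : ℂ) * I ≠ 0 := mul_ne_zero (ofReal_ne_zero.mpr hθ) I_ne_zero
  have heq : (fun t : ℝ ↦ cexp (((θ * t : ℝ) : ℂ) * I)) = fun t : ℝ ↦ cexp ((θ : ℂ) * I * t) := by
    funext t; congr 1; push_cast; ring
  rw [heq, integral_exp_mul_complex hc, norm_div, norm_mul, norm_real, norm_I, mul_one,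
    Real.norm_eq_abs]
  gcongr
  calc ‖cexp ((θ : ℂ) * I * T₂) - cexp ((θ : ℂ) * I * T₁)‖
      ≤ ‖cexp ((θ : ℂ) * I * T₂)‖ + ‖cexp ((θ : ℂ) * I * T₁)‖ := norm_sub_le _ _
    _ = 1 + 1 := by
        have h1 : ∀ T : ℝ, ‖cexp ((θ : ℂ) * I * T)‖ = 1 := fun T ↦ by
          rw [show (θ : ℂ) * I * T = ((θ * T : ℝ) : ℂ) * I by push_cast; ring,
            norm_exp_ofReal_mul_I]
        rw [h1, h1]
    _ = 2 := by norm_num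

/-- Product of a phase and a conjugate phase: `e^{ix} · conj(e^{iy}) = e^{i(x-y)}`. -/
theorem cexp_mul_I_mul_conj_cexp_mul_I (x y : ℝ) :
    cexp ((x : ℂ) * I) * conj (cexp ((y : ℂ) * I)) = cexp (((x - y : ℝ) : ℂ) * I) := by
  rw [← exp_conj, map_mul, conj_ofReal, conj_I, ← Complex.exp_add]
  congr 1; push_cast; ring

/-- Pointwise expansion of `|D(t)|²` for `D(t) = ∑_{i ∈ S} c_i e^{-iν_i t}`:
`|D(t)|² = ∑_{i,j} Re(c_i c̄_j e^{i(ν_j - ν_i)t})`. -/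
theorem norm_sq_expSum_eq {ι : Type*} (S : Finset ι) (ν : ι → ℝ) (c : ι → ℂ) (t : ℝ) :
    ‖∑ i ∈ S, c i * cexp (((-(ν i * t) : ℝ) : ℂ) * I)‖ ^ 2 =
      ∑ i ∈ S, ∑ j ∈ S, (c i * conj (c j) * cexp ((((ν j - ν i) * t : ℝ) : ℂ) * I)).re := by
  obtain ⟨D, hD⟩ : ∃ D : ℂ, D = ∑ i ∈ S, c i * cexp (((-(ν i * t) : ℝ) : ℂ) * I) := ⟨_, rfl⟩
  rw [← hD]
  have h1 : ‖D‖ ^ 2 = (D * conj D).re := by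
    rw [mul_conj, ofReal_re, normSq_eq_norm_sq]
  rw [h1, hD, map_sum, sum_mul_sum, re_sum]
  refine sum_congr rfl fun i _ ↦ ?_
  rw [re_sum]
  refine sum_congr rfl fun j _ ↦ ?_
  congr 1
  rw [map_mul, mul_mul_mul_comm, cexp_mul_I_mul_conj_cexp_mul_I]
  congr 3; push_cast; ring

/-- **Mean value of an exponential sum over an interval (crude Hilbert inequality).** For distinct
real frequencies `ν_i` (`i ∈ S`), coefficients `c_i ∈ ℂ` and real `T₁, T₂` (for `T₂ < T₁` the
left side is `≤ 0` and the bound is trivial):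
`∫_{T₁}^{T₂} |∑_{i∈S} c_i e^{-iν_i t}|² dt ≤ (T₂ - T₁) ∑_i |c_i|² + ∑_i |c_i|² ∑_j 2/|ν_i - ν_j|`
(the `j = i` term is `2/0 = 0`). -/
theorem norm_sq_expSum_intervalIntegral_le {ι : Type*} (S : Finset ι) (ν : ι → ℝ) (c : ι → ℂ)
    (hν : ∀ i ∈ S, ∀ j ∈ S, i ≠ j → ν i ≠ ν j) (T₁ T₂ : ℝ) :
    ∫ t in T₁..T₂, ‖∑ i ∈ S, c i * cexp (((-(ν i * t) : ℝ) : ℂ) * I)‖ ^ 2 ≤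
      (T₂ - T₁) * ∑ i ∈ S, ‖c i‖ ^ 2 + ∑ i ∈ S, ‖c i‖ ^ 2 * ∑ j ∈ S, 2 / |ν i - ν j| := by
  classical
  -- the oscillatory integrals
  obtain ⟨E, hE⟩ : ∃ E : ι → ι → ℂ,
      E = fun i j ↦ ∫ t in T₁..T₂, cexp ((((ν j - ν i) * t : ℝ) : ℂ) * I) := ⟨_, rfl⟩
  have hcont : ∀ i j, Continuous fun t : ℝ ↦
      c i * conj (c j) * cexp ((((ν j - ν i) * t : ℝ) : ℂ) * I) := fun i j ↦
    continuous_const.mul (Complex.continuous_exp.comp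
      ((continuous_ofReal.comp (continuous_const.mul continuous_id')).mul continuous_const))
  -- Step 1: termwise integration
  have hint : ∫ t in T₁..T₂, ‖∑ i ∈ S, c i * cexp (((-(ν i * t) : ℝ) : ℂ) * I)‖ ^ 2 =
      ∑ i ∈ S, ∑ j ∈ S, (c i * conj (c j) * E i j).re := by
    simp_rw [norm_sq_expSum_eq]
    have hre : ∀ i j, Continuous fun t : ℝ ↦
        (c i * conj (c j) * cexp ((((ν j - ν i) * t : ℝ) : ℂ) * I)).re := fun i j ↦
      continuous_re.comp (hcont i j)
    have hI : ∀ i ∈ S, IntervalIntegrable (fun t : ℝ ↦ ∑ j ∈ S,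
        (c i * conj (c j) * cexp ((((ν j - ν i) * t : ℝ) : ℂ) * I)).re) volume T₁ T₂ :=
      fun i _ ↦ (continuous_finsetSum S fun j _ ↦ hre i j).intervalIntegrable _ _
    rw [intervalIntegral.integral_finsetSum hI]
    refine sum_congr rfl fun i _ ↦ ?_
    have hJ : ∀ j ∈ S, IntervalIntegrable (fun t : ℝ ↦
        (c i * conj (c j) * cexp ((((ν j - ν i) * t : ℝ) : ℂ) * I)).re) volume T₁ T₂ :=
      fun j _ ↦ (hre i j).intervalIntegrable _ _
    rw [intervalIntegral.integral_finsetSum hJ]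
    refine sum_congr rfl fun j _ ↦ ?_
    have hK : IntervalIntegrable (fun t : ℝ ↦
        c i * conj (c j) * cexp ((((ν j - ν i) * t : ℝ) : ℂ) * I)) volume T₁ T₂ :=
      (hcont i j).intervalIntegrable _ _
    have h := reCLM.intervalIntegral_comp_comm (𝕜 := ℝ) hK
    simp only [reCLM_apply] at h
    rw [h, intervalIntegral.integral_const_mul, hE]
  -- Step 2: termwise bound
  have hterm : ∀ i ∈ S, ∀ j ∈ S, (c i * conj (c j) * E i j).re ≤
      ‖c i‖ ^ 2 * (T₂ - T₁) * (if i = j then 1 else 0) +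
        (‖c i‖ ^ 2 + ‖c j‖ ^ 2) / |ν i - ν j| := by
    intro i hi j hj
    by_cases hij : i = j
    · subst hij
      have hEii : E i i = ((T₂ - T₁ : ℝ) : ℂ) := by
        rw [hE]
        simp only [sub_self, zero_mul, ofReal_zero, Complex.exp_zero,
          intervalIntegral.integral_const, real_smul, mul_one, ofReal_sub]
      rw [hEii, mul_conj, ← ofReal_mul, ofReal_re, normSq_eq_norm_sq, sub_self, abs_zero,
        div_zero, if_pos rfl]
      all_goals linarith
    · have hθ : ν j - ν i ≠ 0 := sub_ne_zero.mpr (fun h ↦ hν i hi j hj hij h.symm)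
      have hEij : ‖E i j‖ ≤ 2 / |ν j - ν i| := by
        rw [hE]; exact norm_intervalIntegral_cexp_mul_I_le hθ T₁ T₂
      rw [if_neg hij, mul_zero, zero_add, abs_sub_comm (ν i) (ν j)]
      have hpos : 0 < |ν j - ν i| := abs_pos.mpr hθ
      calc (c i * conj (c j) * E i j).re ≤ ‖c i * conj (c j) * E i j‖ := re_le_norm _
        _ = ‖c i‖ * ‖c j‖ * ‖E i j‖ := by rw [norm_mul, norm_mul, RCLike.norm_conj]
        _ ≤ ‖c i‖ * ‖c j‖ * (2 / |ν j - ν i|) := by gcongr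
        _ = (2 * (‖c i‖ * ‖c j‖)) / |ν j - ν i| := by ring
        _ ≤ (‖c i‖ ^ 2 + ‖c j‖ ^ 2) / |ν j - ν i| := by
            gcongr; nlinarith [sq_nonneg (‖c i‖ - ‖c j‖)]
  -- Step 3: sum the bounds
  have hsum : ∑ i ∈ S, ∑ j ∈ S, (‖c i‖ ^ 2 * (T₂ - T₁) * (if i = j then 1 else 0) +
        (‖c i‖ ^ 2 + ‖c j‖ ^ 2) / |ν i - ν j|) =
      (T₂ - T₁) * ∑ i ∈ S, ‖c i‖ ^ 2 + ∑ i ∈ S, ‖c i‖ ^ 2 * ∑ j ∈ S, 2 / |ν i - ν j| := by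
    simp only [add_div, sum_add_distrib]
    have h1 : ∑ i ∈ S, ∑ j ∈ S, ‖c i‖ ^ 2 * (T₂ - T₁) * (if i = j then (1 : ℝ) else 0) =
        (T₂ - T₁) * ∑ i ∈ S, ‖c i‖ ^ 2 := by
      rw [mul_sum]
      refine sum_congr rfl fun i hi ↦ ?_
      simp_rw [mul_ite, mul_one, mul_zero]
      rw [sum_ite_eq S i, if_pos hi]; ring
    have h2 : ∑ i ∈ S, ∑ j ∈ S, ‖c j‖ ^ 2 / |ν i - ν j| =
        ∑ i ∈ S, ∑ j ∈ S, ‖c i‖ ^ 2 / |ν i - ν j| := by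
      rw [sum_comm]
      refine sum_congr rfl fun i _ ↦ sum_congr rfl fun j _ ↦ ?_
      rw [abs_sub_comm]
    have h3 : ∑ i ∈ S, ‖c i‖ ^ 2 * ∑ j ∈ S, 2 / |ν i - ν j| =
        ∑ i ∈ S, ∑ j ∈ S, ‖c i‖ ^ 2 / |ν i - ν j| +
          ∑ i ∈ S, ∑ j ∈ S, ‖c i‖ ^ 2 / |ν i - ν j| := by
      rw [← sum_add_distrib]
      refine sum_congr rfl fun i _ ↦ ?_
      rw [mul_sum, ← sum_add_distrib]
      refine sum_congr rfl fun j _ ↦ ?_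
      ring
    rw [h1, h2, h3]
  rw [hint, ← hsum]
  exact sum_le_sum fun i hi ↦ sum_le_sum fun j hj ↦ hterm i hi j hj

/-- For distinct `n, m ∈ [1, N]`, `|log n - log m| ≥ 1/N`, i.e. `2/|log n - log m| ≤ 2N`; for
`n = m` both sides read `0 ≤ 2N`. -/
theorem two_div_abs_log_sub_log_le {N n m : ℕ} (hn : n ∈ Finset.Icc 1 N)
    (hm : m ∈ Finset.Icc 1 N) : 2 / |Real.log n - Real.log m| ≤ 2 * N := by
  rw [Finset.mem_Icc] at hn hm
  rcases eq_or_ne n m with h | h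
  · subst h; simp
  have hNpos : (0 : ℝ) < N := by exact_mod_cast (show 0 < N by omega)
  -- |log n - log m| ≥ 1/N
  have key : ∀ a b : ℕ, 1 ≤ a → a < b → b ≤ N → 1 / (N : ℝ) ≤ Real.log b - Real.log a := by
    intro a b ha hab hb
    have ha' : (0 : ℝ) < a := by exact_mod_cast ha
    have hb' : (0 : ℝ) < b := by exact_mod_cast (show 0 < b by omega)
    rw [← Real.log_div hb'.ne' ha'.ne']
    have h1 : 1 - (a : ℝ) / b ≤ Real.log ((b : ℝ) / a) := by
      have := Real.one_sub_inv_le_log_of_pos (div_pos hb' ha')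
      rwa [inv_div] at this
    refine le_trans ?_ h1
    have hbN : (b : ℝ) ≤ N := by exact_mod_cast hb
    have h2 : 1 / (N : ℝ) ≤ 1 / b := one_div_le_one_div_of_le hb' hbN
    have h3 : 1 / (b : ℝ) ≤ 1 - a / b := by
      rw [le_sub_iff_add_le, ← add_div, div_le_one hb']
      exact_mod_cast (show 1 + a ≤ b by omega)
    exact h2.trans h3
  have hgap : 1 / (N : ℝ) ≤ |Real.log n - Real.log m| := by
    rcases lt_or_gt_of_ne h with hlt | hgt
    · rw [abs_sub_comm]
      exact (key n m hn.1 hlt hm.2).trans (le_abs_self _)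
    · exact (key m n hm.1 hgt hn.2).trans (le_abs_self _)
  have hpos : 0 < |Real.log n - Real.log m| := lt_of_lt_of_le (by positivity) hgap
  rw [div_le_iff₀ hpos]
  calc (2 : ℝ) = 2 * N * (1 / N) := by field_simp
    _ ≤ 2 * N * |Real.log n - Real.log m| := by gcongr

/-- **Mean value of a Dirichlet polynomial over an interval.** For real `T₁, T₂`, `N : ℕ` and
coefficients `c_n ∈ ℂ`:
`∫_{T₁}^{T₂} |∑_{n=1}^{N} c_n n^{-it}|² dt ≤ (T₂ - T₁ + 2N²) ∑_{n=1}^{N} |c_n|²`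
(`n^{-it}` written as `e^{-i t log n}`). -/
theorem norm_sq_dirichletSum_intervalIntegral_le (N : ℕ) (c : ℕ → ℂ) (T₁ T₂ : ℝ) :
    ∫ t in T₁..T₂, ‖∑ n ∈ Finset.Icc 1 N,
        c n * cexp (((-(Real.log n * t) : ℝ) : ℂ) * I)‖ ^ 2 ≤
      (T₂ - T₁ + 2 * (N : ℝ) ^ 2) * ∑ n ∈ Finset.Icc 1 N, ‖c n‖ ^ 2 := by
  have hν : ∀ i ∈ Finset.Icc 1 N, ∀ j ∈ Finset.Icc 1 N, i ≠ j →
      Real.log i ≠ Real.log j := by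
    intro i hi j hj hij h
    rw [Finset.mem_Icc] at hi hj
    have hi' : (0 : ℝ) < i := by exact_mod_cast hi.1
    have hj' : (0 : ℝ) < j := by exact_mod_cast hj.1
    exact hij (by exact_mod_cast Real.log_injOn_pos hi' hj' h)
  refine (norm_sq_expSum_intervalIntegral_le (Finset.Icc 1 N) (fun n : ℕ ↦ Real.log n) c hν
    T₁ T₂).trans ?_
  have hinner : ∀ n ∈ Finset.Icc 1 N,
      ∑ m ∈ Finset.Icc 1 N, 2 / |Real.log n - Real.log m| ≤ 2 * (N : ℝ) ^ 2 :=
    fun n hn ↦ calc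
      ∑ m ∈ Finset.Icc 1 N, 2 / |Real.log n - Real.log m|
          ≤ ∑ m ∈ Finset.Icc 1 N, (2 * N : ℝ) :=
          sum_le_sum fun m hm ↦ two_div_abs_log_sub_log_le hn hm
      _ = 2 * (N : ℝ) ^ 2 := by rw [sum_const, Nat.card_Icc, nsmul_eq_mul]; push_cast; ring
  have hoff : ∑ n ∈ Finset.Icc 1 N, ‖c n‖ ^ 2 * ∑ m ∈ Finset.Icc 1 N,
      2 / |Real.log n - Real.log m| ≤ ∑ n ∈ Finset.Icc 1 N, ‖c n‖ ^ 2 * (2 * (N : ℝ) ^ 2) :=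
    sum_le_sum fun n hn ↦ mul_le_mul_of_nonneg_left (hinner n hn) (sq_nonneg _)
  rw [← sum_mul] at hoff
  calc (T₂ - T₁) * ∑ n ∈ Finset.Icc 1 N, ‖c n‖ ^ 2 + ∑ n ∈ Finset.Icc 1 N, ‖c n‖ ^ 2 *
          ∑ m ∈ Finset.Icc 1 N, 2 / |Real.log n - Real.log m|
      ≤ (T₂ - T₁) * ∑ n ∈ Finset.Icc 1 N, ‖c n‖ ^ 2 +
          (∑ n ∈ Finset.Icc 1 N, ‖c n‖ ^ 2) * (2 * (N : ℝ) ^ 2) := by gcongr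
    _ = (T₂ - T₁ + 2 * (N : ℝ) ^ 2) * ∑ n ∈ Finset.Icc 1 N, ‖c n‖ ^ 2 := by ring

end Summit.RiemannHypothesis.RiemannHypothesis.Theorems
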